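import Summits.ValiantsHypothesis.ValiantsHypothesis.Theorems.NewtonUnitEquationsTwoProductsConfinedTameLawFibres
import Summits.ValiantsHypothesis.ValiantsHypothesis.Theorems.NewtonUnitEquationsTwoProductsConfinedTameLawSlice
import HarnessLib

/-!
# R10 (`positive-circuit-chart`) — ENGINE F4c: the FIBRE-SUM IDENTITY (upstairs log-coefficient = prefactor · slice function)
Under letter-confinement of the lattice to `Lι`, every fibre `Fib x` is `{fr + b : b ∈ cls x}` with ONE free part `fr` (supported
off `Lι`) and the pattern class `cls x` (supported on `Lι`); the upstairs coefficient of the truncated log series is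
`coeff x (phiT M (logTrunc c d R)) = (-1)^{|fr|+1} (|fr|+B₀−1)!/fr! · Fsl (cls x) B₀ c d ⇑fr`
whenever the pattern masses are `≥ B₀`, `|fr| + B₀ ≥ 1` and the truncation order `R` exceeds all fibre degrees.
R275 P3 scope: tool for the proper positive sub-case rung `ConfinedTameLaw`; nothing here closes 5906; VP ≠ VNP is NOT proved.
-/

noncomputable section
set_option linter.dupNamespace false
set_option linter.unusedSectionVars false

namespace Summit.ValiantsHypothesis.ValiantsHypothesis.Theorems.NewtonUnitEquations.TwoProducts.PermutationType
namespace R10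
open scoped BigOperators
open MvPolynomial
open Summit.ValiantsHypothesis.ValiantsHypothesis.Theorems.NewtonUnitEquations.TwoProducts.FormalLogLinearisation
open Summit.ValiantsHypothesis.ValiantsHypothesis.Theorems.NewtonUnitEquations.TwoProducts.PlanarCell

section Generic
variable {σ : Type*} [Fintype σ] [DecidableEq σ]

/-- The free part of a letter vector (off `Lι`). [folklore] -/
def frP (Lι : Finset σ) (κ : σ →₀ ℕ) : σ →₀ ℕ := κ.filter fun k => k ∉ Lι

/-- The pattern part of a letter vector (on `Lι`). [folklore] -/
def lpP (Lι : Finset σ) (κ : σ →₀ ℕ) : σ →₀ ℕ := κ.filter fun k => k ∈ Lι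

/-- Values of the free part. [folklore] -/
theorem frP_apply (Lι : Finset σ) (κ : σ →₀ ℕ) (k : σ) : frP Lι κ k = if k ∈ Lι then 0 else κ k := by
  unfold frP; rw [Finsupp.filter_apply]; by_cases h : k ∈ Lι <;> simp [h]

/-- Values of the pattern part. [folklore] -/
theorem lpP_apply (Lι : Finset σ) (κ : σ →₀ ℕ) (k : σ) : lpP Lι κ k = if k ∈ Lι then κ k else 0 := by
  unfold lpP; rw [Finsupp.filter_apply]

/-- The split `κ = fr + lp`. [folklore] -/
theorem frP_add_lpP (Lι : Finset σ) (κ : σ →₀ ℕ) : frP Lι κ + lpP Lι κ = κ := by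
  ext k; rw [Finsupp.add_apply, frP_apply, lpP_apply]; by_cases h : k ∈ Lι <;> simp [h]

/-- `mom` is `momF` of the coercion. [folklore] -/
theorem mom_eq_momF (a : σ → ℂ) (κ : σ →₀ ℕ) : mom a κ = momF a ⇑κ := rfl

/-- `mom` is multiplicative. [folklore] -/
theorem mom_add' (a : σ → ℂ) (f g : σ →₀ ℕ) : mom a (f + g) = mom a f * mom a g := by
  rw [mom_eq_momF, mom_eq_momF, mom_eq_momF, Finsupp.coe_add, momF_add]

/-- `deg` is `mass` of the coercion. [folklore] -/
theorem deg_eq_mass (κ : σ →₀ ℕ) : deg κ = mass ⇑κ := by rw [deg_eq_sum]; rfl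

/-- `deg` is additive. [folklore] -/
theorem deg_add' (f g : σ →₀ ℕ) : deg (f + g) = deg f + deg g := by
  rw [deg_eq_mass, deg_eq_mass, deg_eq_mass, Finsupp.coe_add, mass_add]

/-- **Multinomial of a disjointly supported sum**: `(f+g).multinomial · f! · g! = (|f|+|g|)!`. [folklore] -/
theorem multinomial_add_disjoint (f g : σ →₀ ℕ) (h : ∀ i, f i = 0 ∨ g i = 0) :
    (f + g).multinomial * bfact f * bfact g = (deg f + deg g).factorial := by
  set F := f + g with hF
  have sL := Nat.multinomial_spec (Finset.univ : Finset σ) F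
  rw [← multinomial_univ, ← deg_eq_sum] at sL
  have hprod : ∏ i, (F i).factorial = bfact f * bfact g := by
    unfold bfact; rw [← Finset.prod_mul_distrib]
    refine Finset.prod_congr rfl fun i _ => ?_
    rw [hF, Finsupp.add_apply]
    rcases h i with h0 | h0 <;> simp [h0]
  rw [hprod, hF, deg_add'] at sL
  rw [← sL]; ring

/-- The factorial bookkeeping: `(n−1)! = (D+B₀−1)! · asc(D+B₀, B−B₀)` for `n = D + B`, `B ≥ B₀`, `D + B₀ ≥ 1`. [folklore] -/
theorem factorial_pred_eq (D B B₀ : ℕ) (hB : B₀ ≤ B) (h1 : 1 ≤ D + B₀) :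
    (D + B - 1).factorial = (D + B₀ - 1).factorial * (D + B₀).ascFactorial (B - B₀) := by
  have := Nat.factorial_mul_ascFactorial (D + B₀ - 1) (B - B₀)
  rw [show D + B₀ - 1 + 1 = D + B₀ by omega, show D + B₀ - 1 + (B - B₀) = D + B - 1 by omega] at this
  exact this.symm

end Generic

section FibreSum
variable {m : ℕ}
variable {u v : Fin m → MvPolynomial (Fin 2) ℂ}
variable (Ch : ChartData u v) (Lι : Finset (Fin (sE u v)))

/-- Under confinement, all fibre elements have the same free part. [folklore] -/
theorem ChartData.frP_eq_of_mem_Fib (hc : Ch.Confined Lι) {x : Fin Ch.N →₀ ℕ} {κ₀ κ : Fin (sE u v) →₀ ℕ}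
    (h₀ : κ₀ ∈ Ch.Fib x) (h : κ ∈ Ch.Fib x) : frP Lι κ = frP Lι κ₀ := by
  ext k
  rw [frP_apply, frP_apply]
  by_cases hk : k ∈ Lι
  · simp [hk]
  · simp only [hk, if_false]; exact Ch.apply_eq_of_mem_Fib hc h h₀ hk

/-- The pattern class of an upstairs exponent: the pattern parts of its fibre. [folklore] -/
def ChartData.cls (x : Fin Ch.N →₀ ℕ) : Finset (Fin (sE u v) →₀ ℕ) := (Ch.Fib x).image (lpP Lι)

/-- **Fibre sums are class sums**: `Σ_{κ ∈ Fib x} g κ = Σ_{b ∈ cls x} g (fr₀ + b)`. [folklore] -/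
theorem ChartData.sum_Fib_eq_sum_cls (hc : Ch.Confined Lι) {x : Fin Ch.N →₀ ℕ} {κ₀ : Fin (sE u v) →₀ ℕ} (h₀ : κ₀ ∈ Ch.Fib x)
    (g : (Fin (sE u v) →₀ ℕ) → ℂ) : ∑ κ ∈ Ch.Fib x, g κ = ∑ b ∈ Ch.cls Lι x, g (frP Lι κ₀ + b) := by
  classical
  unfold ChartData.cls
  have hinj : Set.InjOn (lpP Lι) ↑(Ch.Fib x) := by
    intro κ hκ κ' hκ' hl
    rw [← frP_add_lpP Lι κ, ← frP_add_lpP Lι κ', Ch.frP_eq_of_mem_Fib Lι hc h₀ hκ, Ch.frP_eq_of_mem_Fib Lι hc h₀ hκ', hl]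
  rw [Finset.sum_image hinj]
  refine Finset.sum_congr rfl fun κ hκ => ?_
  rw [← Ch.frP_eq_of_mem_Fib Lι hc h₀ hκ, frP_add_lpP]

/-- Class elements are supported on `Lι`; the free part off `Lι`. [folklore] -/
theorem disjoint_frP_cls {x : Fin Ch.N →₀ ℕ} (κ₀ : Fin (sE u v) →₀ ℕ) {b : Fin (sE u v) →₀ ℕ} (hb : b ∈ Ch.cls Lι x) :
    ∀ i, frP Lι κ₀ i = 0 ∨ b i = 0 := by
  classical
  unfold ChartData.cls at hb
  obtain ⟨κ, -, rfl⟩ := Finset.mem_image.mp hb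
  intro i
  rw [frP_apply, lpP_apply]
  by_cases hi : i ∈ Lι <;> simp [hi]

/-- **THE FIBRE-SUM IDENTITY**: the upstairs coefficient of the truncated log series is the nonvanishing prefactor
`(-1)^{|fr|+1} (|fr|+B₀−1)!/fr!` times the slice function of the class at the free part. [folklore] -/
theorem ChartData.coeff_logTrunc_eq_Fsl (hc : Ch.Confined Lι) (c d : Fin m → Fin (sE u v) → ℂ) (R B₀ : ℕ)
    {x : Fin Ch.N →₀ ℕ} {κ₀ : Fin (sE u v) →₀ ℕ} (h₀ : κ₀ ∈ Ch.Fib x)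
    (hB : ∀ b ∈ Ch.cls Lι x, B₀ ≤ deg b) (h1 : 1 ≤ deg (frP Lι κ₀) + B₀) (hR : ∀ κ ∈ Ch.Fib x, deg κ ≤ R) :
    coeff x (phiT Ch.M (logTrunc c d R)) =
      (-1 : ℂ) ^ (deg (frP Lι κ₀) + 1) * (((deg (frP Lι κ₀) + B₀ - 1).factorial : ℕ) : ℂ) / ((bfact (frP Lι κ₀) : ℕ) : ℂ) *
        Fsl (Ch.cls Lι x) B₀ c d ⇑(frP Lι κ₀) := by
  classical
  set fr := frP Lι κ₀ with hfr
  rw [Ch.coeff_phiT_eq_sum_Fib, Ch.sum_Fib_eq_sum_cls Lι hc h₀]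
  unfold Fsl
  rw [Finset.mul_sum]
  refine Finset.sum_congr rfl fun b hb => ?_
  -- the fibre element fr + b
  have hmem : fr + b ∈ Ch.Fib x := by
    unfold ChartData.cls at hb
    obtain ⟨κ, hκ, rfl⟩ := Finset.mem_image.mp hb
    rw [hfr, ← Ch.frP_eq_of_mem_Fib Lι hc h₀ hκ, frP_add_lpP]; exact hκ
  have hdisj := disjoint_frP_cls Ch Lι κ₀ hb
  have hdeg : deg (fr + b) = deg fr + deg b := deg_add' fr b
  have hBb := hB b hb
  have hdeg1 : 1 ≤ deg (fr + b) := by rw [hdeg]; omega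
  have hdegR : deg (fr + b) ≤ R := hR _ hmem
  rw [coeff_logTrunc c d R (fr + b) hdeg1 hdegR]
  -- multinomial and factorial bookkeeping
  have hmult := multinomial_add_disjoint fr b hdisj
  have hfac := factorial_pred_eq (deg fr) (deg b) B₀ hBb h1
  have hn : deg (fr + b) = (deg fr + deg b - 1) + 1 := by rw [hdeg]; omega
  have hbf : (bfact fr : ℂ) ≠ 0 := by
    unfold bfact; exact Nat.cast_ne_zero.mpr (Finset.prod_ne_zero_iff.mpr fun i _ => Nat.factorial_ne_zero _)
  have hbb : (bfact b : ℂ) ≠ 0 := by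
    unfold bfact; exact Nat.cast_ne_zero.mpr (Finset.prod_ne_zero_iff.mpr fun i _ => Nat.factorial_ne_zero _)
  have hnz : ((deg (fr + b) : ℕ) : ℂ) ≠ 0 := Nat.cast_ne_zero.mpr (by omega)
  -- the monomial part
  have hS : ∑ j, mom (c j) (fr + b) - ∑ j, mom (d j) (fr + b) =
      ∑ j, (momF (c j) ⇑fr * mom (c j) b - momF (d j) ⇑fr * mom (d j) b) := by
    rw [← Finset.sum_sub_distrib]
    refine Finset.sum_congr rfl fun j _ => ?_
    rw [mom_add', mom_add', mom_eq_momF (c j) fr, mom_eq_momF (d j) fr]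
  -- scalar bookkeeping in ℕ, then cast
  have hkey : (deg fr + deg b).factorial =
      (deg fr + deg b) * ((deg fr + B₀ - 1).factorial * (deg fr + B₀).ascFactorial (deg b - B₀)) := by
    rw [← hfac]
    conv_lhs => rw [show deg fr + deg b = (deg fr + deg b - 1) + 1 by omega]
    rw [Nat.factorial_succ]
    congr 1
    omega
  have hmultC : ((fr + b).multinomial : ℂ) =
      ((deg fr + deg b : ℕ) : ℂ) * ((((deg fr + B₀ - 1).factorial : ℕ) : ℂ) * (((deg fr + B₀).ascFactorial (deg b - B₀) : ℕ) : ℂ)) /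
        ((bfact fr : ℂ) * (bfact b : ℂ)) := by
    rw [eq_div_iff (mul_ne_zero hbf hbb)]
    have e : ((fr + b).multinomial * (bfact fr * bfact b) : ℕ) = (deg fr + deg b) *
        ((deg fr + B₀ - 1).factorial * (deg fr + B₀).ascFactorial (deg b - B₀)) := by rw [← mul_assoc, hmult, hkey]
    have e' : (((fr + b).multinomial : ℕ) : ℂ) * ((bfact fr : ℂ) * (bfact b : ℂ)) =
        ((deg fr + deg b : ℕ) : ℂ) * ((((deg fr + B₀ - 1).factorial : ℕ) : ℂ) *
          (((deg fr + B₀).ascFactorial (deg b - B₀) : ℕ) : ℂ)) := by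
      exact_mod_cast e
    exact e'
  rw [hS, hmultC, hdeg]
  unfold wP
  rw [← deg_eq_mass fr]
  have hn' : ((deg fr + deg b : ℕ) : ℂ) ≠ 0 := by rw [← hdeg]; exact hnz
  field_simp
  ring

end FibreSum

end R10
end Summit.ValiantsHypothesis.ValiantsHypothesis.Theorems.NewtonUnitEquations.TwoProducts.PermutationType

end
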